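import Mathlib
import Literature.MeasureTheory.Integral.HPolyhedronFacetSumAssembly
import HarnessLib

/-!
# Gauss–Green for convex H-polytopes in `ℝ³` (coordinates `Fin 3 → ℝ`), facet-chart form (brick T1)

Topic `Literature/MeasureTheory/Integral`; namespace `Literature.MeasureTheory.Integral`.
For a compact H-polytope `P = {x | ∀ j ∈ J, Σ_l a_{jl} x_l ≤ b_j}` in `Fin 3 → ℝ` with unit normals
`a_j`, pairwise non-proportional constraints `(a_j, b_j)`, bounded in every coordinate direction by
constraints of both signs, and isometric charts `Φ_j y = p_j + y₁U_j + y₂V_j` of the constraint planes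
(`(U_j, V_j, a_j)` orthonormal in coordinates), and for a `C¹`-type field given by components
`η_i` with continuous partial derivatives `dη_i = ∂_i η_i`:
`∫_P Σ_i ∂_i η_i = Σ_{j ∈ J} Σ_i a_{ji} ∫_{y ∈ ℝ²} 1_P(Φ_j y) η_i(Φ_j y) dy`
(`setIntegral_divergence_hPolytope_eq_facetSum`), i.e. `∫_P div η = Σ_F ∫_F ⟪η, ν_F⟫ dσ` with the
facet integrals written in charts.  Proof: for each coordinate direction `i`, transport to the vertical
coordinates `(Fin 3 → ℝ) ≃ (ℝ × ℝ) × ℝ` (`x ↦ ((x_{i⁺0}, x_{i⁺1}), x_i)`, volume preserving) and apply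
the facet-chart form of the vertical Gauss–Green integral (`setIntegral_deriv_hPolyhedron_eq_facetSum`,
bricks L1–L4 + T1(i) of this topic); then sum over `i`.  This is the polytope case of the Gauss–Green
theorem that Mathlib lacks beyond rectangular boxes; consumer: the facet formula for the anisotropic
perimeter of polyhedral sets (crystal3d-full, line PolyDensity of stmt-Ventures-19482).
-/

noncomputable section

namespace Literature.MeasureTheory.Integral

open _root_.MeasureTheory Set Finset

variable {ι : Type*} [LinearOrder ι]

/-! ### Vertical coordinates `(Fin 3 → ℝ) ≃ᵐ (ℝ × ℝ) × ℝ` adapted to a direction `i` -/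

/-- The coordinate split `x ↦ ((x_{i.succAbove 0}, x_{i.succAbove 1}), x_i)`: its value.
[cite: EvansGariepy2015, Thm 5.16 (Gauss–Green) — plumbing] -/
theorem verticalCoords_apply (i : Fin 3) (x : Fin 3 → ℝ) :
    (((MeasurableEquiv.piFinSuccAbove (fun _ => ℝ) i).trans MeasurableEquiv.prodComm).trans
      (MeasurableEquiv.finTwoArrow.prodCongr (MeasurableEquiv.refl ℝ))) x =
      ((x (i.succAbove 0), x (i.succAbove 1)), x i) := rfl

/-- … its inverse. [cite: EvansGariepy2015, Thm 5.16 (Gauss–Green) — plumbing] -/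
theorem verticalCoords_symm_apply (i : Fin 3) (q : (ℝ × ℝ) × ℝ) :
    (((MeasurableEquiv.piFinSuccAbove (fun _ => ℝ) i).trans MeasurableEquiv.prodComm).trans
      (MeasurableEquiv.finTwoArrow.prodCongr (MeasurableEquiv.refl ℝ))).symm q =
      i.insertNth q.2 ![q.1.1, q.1.2] := by
  ext l
  simp [MeasurableEquiv.piFinSuccAbove_symm_apply, Fin.insertNthEquiv, MeasurableEquiv.finTwoArrow,
    MeasurableEquiv.prodCongr, MeasurableEquiv.prodComm]

/-- … it preserves Lebesgue measure. [cite: EvansGariepy2015, Thm 5.16 (Gauss–Green) — plumbing] -/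
theorem measurePreserving_verticalCoords (i : Fin 3) :
    MeasurePreserving (((MeasurableEquiv.piFinSuccAbove (fun _ => ℝ) i).trans
      MeasurableEquiv.prodComm).trans (MeasurableEquiv.finTwoArrow.prodCongr (MeasurableEquiv.refl ℝ)))
      volume volume := by
  refine MeasurePreserving.trans ?_
    ((volume_preserving_finTwoArrow ℝ).prod (MeasurePreserving.id volume))
  exact (volume_preserving_piFinSuccAbove (fun _ => ℝ) i).trans Measure.measurePreserving_swap

/-- A sum over `Fin 3` split along `i`. [cite: EvansGariepy2015, Thm 5.16 (Gauss–Green) — plumbing] -/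
theorem sum_fin3_succAbove (i : Fin 3) (f : Fin 3 → ℝ) :
    ∑ l, f l = f (i.succAbove 0) + f (i.succAbove 1) + f i := by
  rw [Fin.sum_univ_succAbove f i, Fin.sum_univ_two]; ring

/-- Values of the inverse coordinate map. [cite: EvansGariepy2015, Thm 5.16 (Gauss–Green) — plumbing] -/
theorem insertNth_vals (i : Fin 3) (q : (ℝ × ℝ) × ℝ) :
    (i.insertNth q.2 ![q.1.1, q.1.2] : Fin 3 → ℝ) i = q.2 ∧
    (i.insertNth q.2 ![q.1.1, q.1.2] : Fin 3 → ℝ) (i.succAbove 0) = q.1.1 ∧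
    (i.insertNth q.2 ![q.1.1, q.1.2] : Fin 3 → ℝ) (i.succAbove 1) = q.1.2 := by
  refine ⟨by simp, ?_, ?_⟩
  · rw [Fin.insertNth_apply_succAbove]; simp
  · rw [Fin.insertNth_apply_succAbove]; simp

/-- Continuity of the inverse coordinate map. [cite: EvansGariepy2015, Thm 5.16 (Gauss–Green) — plumbing] -/
theorem continuous_insertNth_coords (i : Fin 3) :
    Continuous fun q : (ℝ × ℝ) × ℝ => (i.insertNth q.2 ![q.1.1, q.1.2] : Fin 3 → ℝ) := by
  refine continuous_pi fun l => ?_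
  rcases Fin.eq_self_or_eq_succAbove i l with rfl | ⟨k, rfl⟩
  · simp only [Fin.insertNth_apply_same]; fun_prop
  · simp only [Fin.insertNth_apply_succAbove]
    fin_cases k <;> simp <;> fun_prop

/-! ### Non-proportional constraints have distinct graphs in every vertical coordinate system -/

/-- If `(a_k, b_k)` is not a multiple of `(a_j, b_j)` and both constraints are non-vertical in direction
`i`, their graph functions over the `(i⁺0, i⁺1)`-plane differ somewhere.
[cite: EvansGariepy2015, Thm 5.16 (Gauss–Green) — plumbing] -/
theorem exists_graph_ne_of_not_proportional (i : Fin 3) {a₁ a₂ : Fin 3 → ℝ} {b₁ b₂ : ℝ}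
    (h1 : a₁ i ≠ 0) (h2 : a₂ i ≠ 0) (hnd : ¬ ∃ μ : ℝ, (∀ l, a₂ l = μ * a₁ l) ∧ b₂ = μ * b₁) :
    ∃ x : ℝ × ℝ, (b₁ - a₁ (i.succAbove 0) * x.1 - a₁ (i.succAbove 1) * x.2) / a₁ i ≠
      (b₂ - a₂ (i.succAbove 0) * x.1 - a₂ (i.succAbove 1) * x.2) / a₂ i := by
  by_contra hall
  have heq : ∀ x : ℝ × ℝ, (b₁ - a₁ (i.succAbove 0) * x.1 - a₁ (i.succAbove 1) * x.2) / a₁ i =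
      (b₂ - a₂ (i.succAbove 0) * x.1 - a₂ (i.succAbove 1) * x.2) / a₂ i :=
    fun x => by by_contra hx; exact hall ⟨x, hx⟩
  apply hnd
  refine ⟨a₂ i / a₁ i, fun l => ?_, ?_⟩
  · rcases Fin.eq_self_or_eq_succAbove i l with rfl | ⟨k, rfl⟩
    · field_simp
    · fin_cases k
      · have e0 := heq (0, 0)
        have e1 := heq (1, 0)
        simp only [mul_zero, mul_one, sub_zero] at e0 e1
        field_simp at e0 e1
        field_simp
        simp
        linear_combination e1 - e0
      · have e0 := heq (0, 0)
        have e1 := heq (0, 1)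
        simp only [mul_zero, mul_one, sub_zero] at e0 e1
        field_simp at e0 e1
        field_simp
        simp
        linear_combination e1 - e0
  · have e0 := heq (0, 0)
    simp only [mul_zero, sub_zero] at e0
    field_simp at e0
    field_simp
    linear_combination -e0

/-! ### One coordinate direction -/

/-- **Partial Gauss–Green in direction `i` for a compact H-polytope, facet-chart form.**
`∫_P ∂_i η = Σ_{j ∈ J} a_{ji} ∫ 1_P(Φ_j y) η(Φ_j y) dy` (hypotheses as in the module docstring; `η` is
one component of the field, `dη = ∂_i η`).
[cite: EvansGariepy2015, Thm 5.16 (Gauss–Green), polyhedral case, one coordinate direction] -/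
theorem setIntegral_partialDeriv_hPolytope_eq_facetSum (i : Fin 3) {J : Finset ι}
    (a : ι → Fin 3 → ℝ) (b : ι → ℝ) (ha1 : ∀ j ∈ J, ∑ l, a j l ^ 2 = 1)
    (hup : (J.filter fun j => 0 < a j i).Nonempty) (hlow : (J.filter fun j => a j i < 0).Nonempty)
    (hnd : ∀ j ∈ J, ∀ k ∈ J, j ≠ k → ¬ ∃ μ : ℝ, (∀ l, a k l = μ * a j l) ∧ b k = μ * b j)
    (p U V : ι → Fin 3 → ℝ) (hp : ∀ j ∈ J, ∑ l, a j l * p j l = b j)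
    (hU : ∀ j ∈ J, ∑ l, a j l * U j l = 0) (hV : ∀ j ∈ J, ∑ l, a j l * V j l = 0)
    (hU1 : ∀ j ∈ J, ∑ l, U j l ^ 2 = 1) (hV1 : ∀ j ∈ J, ∑ l, V j l ^ 2 = 1)
    (hUV : ∀ j ∈ J, ∑ l, U j l * V j l = 0)
    (hPc : IsCompact {x : Fin 3 → ℝ | ∀ j ∈ J, ∑ l, a j l * x l ≤ b j})
    {η dη : (Fin 3 → ℝ) → ℝ} (hη : Continuous η) (hdη : Continuous dη)
    (hderiv : ∀ x, HasDerivAt (fun s => η (Function.update x i s)) (dη x) (x i)) :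
    ∫ x in {x : Fin 3 → ℝ | ∀ j ∈ J, ∑ l, a j l * x l ≤ b j}, dη x =
      ∑ j ∈ J, a j i * ∫ y : ℝ × ℝ, {x : Fin 3 → ℝ | ∀ j ∈ J, ∑ l, a j l * x l ≤ b j}.indicator
        (fun _ => (1 : ℝ)) (p j + y.1 • U j + y.2 • V j) * η (p j + y.1 • U j + y.2 • V j) := by
  classical
  set Ψ := ((MeasurableEquiv.piFinSuccAbove (fun _ => ℝ) i).trans MeasurableEquiv.prodComm).trans
      (MeasurableEquiv.finTwoArrow.prodCongr (MeasurableEquiv.refl ℝ)) with hΨdef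
  set P : Set (Fin 3 → ℝ) := {x | ∀ j ∈ J, ∑ l, a j l * x l ≤ b j} with hP
  -- the constraint data in vertical coordinates
  set α : ι → ℝ := fun j => a j (i.succAbove 0) with hα
  set β : ι → ℝ := fun j => a j (i.succAbove 1) with hβ
  set c : ι → ℝ := fun j => a j i with hc
  set P' : Set ((ℝ × ℝ) × ℝ) := {q | ∀ j ∈ J, α j * q.1.1 + β j * q.1.2 + c j * q.2 ≤ b j} with hP'
  have hΨ : ∀ x, Ψ x = ((x (i.succAbove 0), x (i.succAbove 1)), x i) := fun x => rfl
  have hΨsymm : ∀ q, Ψ.symm q = i.insertNth q.2 ![q.1.1, q.1.2] := verticalCoords_symm_apply i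
  have hΨmp : MeasurePreserving Ψ volume volume := measurePreserving_verticalCoords i
  have hΨc : Continuous Ψ := by
    rw [show (Ψ : (Fin 3 → ℝ) → (ℝ × ℝ) × ℝ) = fun x => ((x (i.succAbove 0), x (i.succAbove 1)), x i)
      from funext hΨ]
    fun_prop
  have hΨsc : Continuous Ψ.symm := by
    rw [show (Ψ.symm : ((ℝ × ℝ) × ℝ) → (Fin 3 → ℝ)) = fun q => i.insertNth q.2 ![q.1.1, q.1.2]
      from funext hΨsymm]
    exact continuous_insertNth_coords i
  have hlin : ∀ (f x : Fin 3 → ℝ), ∑ l, f l * x l =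
      f (i.succAbove 0) * x (i.succAbove 0) + f (i.succAbove 1) * x (i.succAbove 1) + f i * x i :=
    fun f x => sum_fin3_succAbove i _
  have hform : ∀ (q : (ℝ × ℝ) × ℝ) (f : Fin 3 → ℝ),
      ∑ l, f l * (i.insertNth q.2 ![q.1.1, q.1.2] : Fin 3 → ℝ) l =
        f (i.succAbove 0) * q.1.1 + f (i.succAbove 1) * q.1.2 + f i * q.2 := by
    intro q f
    obtain ⟨h0, h1, h2⟩ := insertNth_vals i q
    rw [hlin, h0, h1, h2]
  -- the image of `P`
  have hPimg : Ψ '' P = P' := by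
    ext q
    simp only [Set.mem_image, hP, hP', Set.mem_setOf_eq]
    constructor
    · rintro ⟨x, hx, rfl⟩ j hj
      have h1 := hx j hj
      rw [hlin] at h1
      rw [hΨ]
      exact h1
    · intro hq
      refine ⟨Ψ.symm q, fun j hj => ?_, Ψ.apply_symm_apply q⟩
      rw [hΨsymm, hform]
      exact hq j hj
  have hP'c : IsCompact P' := hPimg ▸ hPc.image hΨc
  have hmemP : ∀ z, Ψ z ∈ P' ↔ z ∈ P := by
    intro z; rw [← hPimg]; exact Ψ.injective.mem_set_image
  -- the planes are distinct in these coordinates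
  have hnd' : ∀ j ∈ J, ∀ k ∈ J, j ≠ k → c j ≠ 0 → c k ≠ 0 →
      ∃ x : ℝ × ℝ, (b j - α j * x.1 - β j * x.2) / c j ≠ (b k - α k * x.1 - β k * x.2) / c k :=
    fun j hj k hk hjk hcj hck => exists_graph_ne_of_not_proportional i hcj hck (hnd j hj k hk hjk)
  -- chart data in the new coordinates
  have hp' : ∀ j ∈ J, c j ≠ 0 →
      α j * (Ψ (p j)).1.1 + β j * (Ψ (p j)).1.2 + c j * (Ψ (p j)).2 = b j := by
    intro j hj _; rw [hΨ]; simp only []; rw [← hp j hj, hlin]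
  have hU' : ∀ j ∈ J, c j ≠ 0 →
      α j * (Ψ (U j)).1.1 + β j * (Ψ (U j)).1.2 + c j * (Ψ (U j)).2 = 0 := by
    intro j hj _; rw [hΨ]; simp only []; rw [← hU j hj, hlin]
  have hV' : ∀ j ∈ J, c j ≠ 0 →
      α j * (Ψ (V j)).1.1 + β j * (Ψ (V j)).1.2 + c j * (Ψ (V j)).2 = 0 := by
    intro j hj _; rw [hΨ]; simp only []; rw [← hV j hj, hlin]
  have hU1' : ∀ j ∈ J, c j ≠ 0 →
      (Ψ (U j)).1.1 ^ 2 + (Ψ (U j)).1.2 ^ 2 + (Ψ (U j)).2 ^ 2 = 1 := by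
    intro j hj _; rw [hΨ]; simp only []; rw [← hU1 j hj, sum_fin3_succAbove i]
  have hV1' : ∀ j ∈ J, c j ≠ 0 →
      (Ψ (V j)).1.1 ^ 2 + (Ψ (V j)).1.2 ^ 2 + (Ψ (V j)).2 ^ 2 = 1 := by
    intro j hj _; rw [hΨ]; simp only []; rw [← hV1 j hj, sum_fin3_succAbove i]
  have hUV' : ∀ j ∈ J, c j ≠ 0 →
      (Ψ (U j)).1.1 * (Ψ (V j)).1.1 + (Ψ (U j)).1.2 * (Ψ (V j)).1.2 + (Ψ (U j)).2 * (Ψ (V j)).2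
        = 0 := by
    intro j hj _; rw [hΨ, hΨ]; simp only []; rw [← hUV j hj, sum_fin3_succAbove i]
  -- the transported functions
  have hupdate : ∀ (x' : ℝ × ℝ) (t s : ℝ),
      Ψ.symm (x', s) = Function.update (Ψ.symm (x', t)) i s := by
    intro x' t s
    rw [hΨsymm, hΨsymm]
    ext l
    rcases Fin.eq_self_or_eq_succAbove i l with rfl | ⟨k, rfl⟩
    · simp
    · rw [Function.update_of_ne (Fin.succAbove_ne _ k), Fin.insertNth_apply_succAbove,
        Fin.insertNth_apply_succAbove]
  have hderiv' : ∀ (x' : ℝ × ℝ) (t : ℝ),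
      HasDerivAt (fun s => η (Ψ.symm (x', s))) (dη (Ψ.symm (x', t))) t := by
    intro x' t
    have hz : (Ψ.symm (x', t)) i = t := by rw [hΨsymm]; simp
    have h := hderiv (Ψ.symm (x', t))
    rw [hz] at h
    have hfun : (fun s => η (Ψ.symm (x', s))) =
        fun s => η (Function.update (Ψ.symm (x', t)) i s) := funext fun s => by rw [hupdate x' t s]
    rw [hfun]; exact h
  have hcont' : Continuous fun q => dη (Ψ.symm q) := hdη.comp hΨsc
  have hint' : IntegrableOn (fun q => dη (Ψ.symm q)) P' volume :=
    hcont'.continuousOn.integrableOn_compact hP'c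
  -- the base and the two graphs; compactness of the base
  have hA : ∀ k, Continuous (fun x : ℝ × ℝ => α k * x.1 + β k * x.2) := fun k => by fun_prop
  have hhic := continuous_hiGraph (A := fun k (x : ℝ × ℝ) => α k * x.1 + β k * x.2) hA c b hup
  have hloc := continuous_loGraph (A := fun k (x : ℝ × ℝ) => α k * x.1 + β k * x.2) hA c b hlow
  have hPeq := setOf_hConstraints_eq_between_graphs (J := J)
    (fun k (x : ℝ × ℝ) => α k * x.1 + β k * x.2) c b hup hlow
  set hi : ℝ × ℝ → ℝ := fun x => (J.filter fun j => 0 < c j).inf' hup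
    (fun j => (b j - (α j * x.1 + β j * x.2)) / c j) with hhi
  set lo : ℝ × ℝ → ℝ := fun x => (J.filter fun j => c j < 0).sup' hlow
    (fun j => (b j - (α j * x.1 + β j * x.2)) / c j) with hlo
  set D : Set (ℝ × ℝ) := {x | (∀ j ∈ J, c j = 0 → α j * x.1 + β j * x.2 ≤ b j) ∧ lo x ≤ hi x}
    with hD
  have hDsub : D ⊆ Prod.fst '' P' := by
    intro x hx
    refine ⟨(x, hi x), ?_, rfl⟩
    have : (x, hi x) ∈ {q : (ℝ × ℝ) × ℝ | q.1 ∈ D ∧ lo q.1 ≤ q.2 ∧ q.2 ≤ hi q.1} :=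
      ⟨hx, hx.2, le_rfl⟩
    have hPeq' : P' = {q : (ℝ × ℝ) × ℝ | q.1 ∈ D ∧ lo q.1 ≤ q.2 ∧ q.2 ≤ hi q.1} := hPeq
    rw [hPeq']; exact this
  have hDclosed : IsClosed D := by
    have h1 : IsClosed {x : ℝ × ℝ | ∀ j ∈ J, c j = 0 → α j * x.1 + β j * x.2 ≤ b j} := by
      have : {x : ℝ × ℝ | ∀ j ∈ J, c j = 0 → α j * x.1 + β j * x.2 ≤ b j} =
          ⋂ j ∈ J, {x : ℝ × ℝ | c j = 0 → α j * x.1 + β j * x.2 ≤ b j} := by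
        ext x; simp only [Set.mem_setOf_eq, Set.mem_iInter]
      rw [this]
      refine isClosed_biInter fun j _ => ?_
      by_cases hcj : c j = 0
      · have : {x : ℝ × ℝ | c j = 0 → α j * x.1 + β j * x.2 ≤ b j} = {x | α j * x.1 + β j * x.2 ≤ b j} := by
          ext x; simp [hcj]
        rw [this]; exact isClosed_le (hA j) continuous_const
      · have : {x : ℝ × ℝ | c j = 0 → α j * x.1 + β j * x.2 ≤ b j} = Set.univ := by
          ext x; simp [hcj]
        rw [this]; exact isClosed_univ
    have h2 : IsClosed {x : ℝ × ℝ | lo x ≤ hi x} := isClosed_le hloc hhic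
    simpa only [hD, Set.setOf_and] using h1.inter h2
  have hDc : IsCompact D := (hP'c.image continuous_fst).of_isClosed_subset hDclosed hDsub
  have hghi' : IntegrableOn (fun x : ℝ × ℝ => η (Ψ.symm (x, hi x))) D volume := by
    refine ContinuousOn.integrableOn_compact hDc (Continuous.continuousOn ?_)
    exact hη.comp (hΨsc.comp (continuous_id.prodMk hhic))
  have hglo' : IntegrableOn (fun x : ℝ × ℝ => η (Ψ.symm (x, lo x))) D volume := by
    refine ContinuousOn.integrableOn_compact hDc (Continuous.continuousOn ?_)
    exact hη.comp (hΨsc.comp (continuous_id.prodMk hloc))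
  -- transport of the left-hand side
  have hT : ∫ x in P, dη x = ∫ q in P', dη (Ψ.symm q) := by
    rw [← hPimg, hΨmp.setIntegral_image_emb Ψ.measurableEmbedding]
    simp only [MeasurableEquiv.symm_apply_apply]
  -- the facet-sum formula in vertical coordinates
  have hmain := setIntegral_deriv_hPolyhedron_eq_facetSum α β c b hup hlow hnd'
    (fun j => Ψ (p j)) (fun j => Ψ (U j)) (fun j => Ψ (V j)) hp' hU' hV' hU1' hV1' hUV'
    (g := fun q => η (Ψ.symm q)) (g' := fun q => dη (Ψ.symm q)) hderiv' hcont' hint' hghi' hglo'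
  rw [hT, hmain]
  -- rewrite each term back in `Fin 3 → ℝ`
  have hterm : ∀ j ∈ J, c j / Real.sqrt (α j ^ 2 + β j ^ 2 + c j ^ 2) *
      ∫ y : ℝ × ℝ, P'.indicator (fun _ => (1 : ℝ)) (Ψ (p j) + y.1 • Ψ (U j) + y.2 • Ψ (V j)) *
        η (Ψ.symm (Ψ (p j) + y.1 • Ψ (U j) + y.2 • Ψ (V j))) =
      a j i * ∫ y : ℝ × ℝ, P.indicator (fun _ => (1 : ℝ)) (p j + y.1 • U j + y.2 • V j) *
        η (p j + y.1 • U j + y.2 • V j) := by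
    intro j hj
    have hnorm : Real.sqrt (α j ^ 2 + β j ^ 2 + c j ^ 2) = 1 := by
      rw [show α j ^ 2 + β j ^ 2 + c j ^ 2 = ∑ l, a j l ^ 2 from
          (sum_fin3_succAbove i (fun l => a j l ^ 2)).symm,
        ha1 j hj, Real.sqrt_one]
    rw [hnorm, div_one]
    congr 1
    refine integral_congr_ae (Filter.Eventually.of_forall fun y => ?_)
    have hchart : Ψ (p j) + y.1 • Ψ (U j) + y.2 • Ψ (V j) = Ψ (p j + y.1 • U j + y.2 • V j) := rfl
    beta_reduce
    rw [hchart, MeasurableEquiv.symm_apply_apply]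
    congr 1
    by_cases hz : p j + y.1 • U j + y.2 • V j ∈ P
    · rw [Set.indicator_of_mem hz, Set.indicator_of_mem ((hmemP _).2 hz)]
    · rw [Set.indicator_of_notMem hz, Set.indicator_of_notMem (fun h => hz ((hmemP _).1 h))]
  rw [Finset.sum_congr rfl fun j hj => hterm j (Finset.mem_filter.1 hj).1]
  exact Finset.sum_filter_of_ne fun j _ hne => left_ne_zero_of_mul hne

/-! ### The divergence form -/

/-- **Gauss–Green for compact H-polytopes in `ℝ³` (coordinates `Fin 3 → ℝ`), facet-chart form.**
For `P = {x | ∀ j ∈ J, Σ_l a_{jl} x_l ≤ b_j}` compact, with unit, pairwise non-proportional constraints,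
constraints of both signs in every coordinate direction, isometric charts `Φ_j y = p_j + y₁U_j + y₂V_j`
of the constraint planes, and a field with components `η_i` and continuous partials `dη_i = ∂_i η_i`:
`∫_P Σ_i ∂_i η_i = Σ_{j ∈ J} Σ_i a_{ji} ∫ 1_P(Φ_j y) η_i(Φ_j y) dy` (= `Σ_F ∫_F ⟪η, ν_F⟫ dσ`).
[cite: EvansGariepy2015, Thm 5.16 (Gauss–Green), polyhedral case] -/
theorem setIntegral_divergence_hPolytope_eq_facetSum {J : Finset ι}
    (a : ι → Fin 3 → ℝ) (b : ι → ℝ) (ha1 : ∀ j ∈ J, ∑ l, a j l ^ 2 = 1)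
    (hbd : ∀ i : Fin 3,
      (J.filter fun j => 0 < a j i).Nonempty ∧ (J.filter fun j => a j i < 0).Nonempty)
    (hnd : ∀ j ∈ J, ∀ k ∈ J, j ≠ k → ¬ ∃ μ : ℝ, (∀ l, a k l = μ * a j l) ∧ b k = μ * b j)
    (p U V : ι → Fin 3 → ℝ) (hp : ∀ j ∈ J, ∑ l, a j l * p j l = b j)
    (hU : ∀ j ∈ J, ∑ l, a j l * U j l = 0) (hV : ∀ j ∈ J, ∑ l, a j l * V j l = 0)
    (hU1 : ∀ j ∈ J, ∑ l, U j l ^ 2 = 1) (hV1 : ∀ j ∈ J, ∑ l, V j l ^ 2 = 1)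
    (hUV : ∀ j ∈ J, ∑ l, U j l * V j l = 0)
    (hPc : IsCompact {x : Fin 3 → ℝ | ∀ j ∈ J, ∑ l, a j l * x l ≤ b j})
    {η dη : Fin 3 → (Fin 3 → ℝ) → ℝ} (hη : ∀ i, Continuous (η i)) (hdη : ∀ i, Continuous (dη i))
    (hderiv : ∀ i x, HasDerivAt (fun s => η i (Function.update x i s)) (dη i x) (x i)) :
    ∫ x in {x : Fin 3 → ℝ | ∀ j ∈ J, ∑ l, a j l * x l ≤ b j}, ∑ i, dη i x =
      ∑ j ∈ J, ∑ i, a j i * ∫ y : ℝ × ℝ, {x : Fin 3 → ℝ | ∀ j ∈ J, ∑ l, a j l * x l ≤ b j}.indicator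
        (fun _ => (1 : ℝ)) (p j + y.1 • U j + y.2 • V j) * η i (p j + y.1 • U j + y.2 • V j) := by
  classical
  have hint : ∀ i, IntegrableOn (dη i) {x : Fin 3 → ℝ | ∀ j ∈ J, ∑ l, a j l * x l ≤ b j} volume :=
    fun i => (hdη i).continuousOn.integrableOn_compact hPc
  rw [integral_finsetSum _ (fun i _ => hint i), Finset.sum_comm]
  exact Finset.sum_congr rfl fun i _ => setIntegral_partialDeriv_hPolytope_eq_facetSum i a b ha1
    (hbd i).1 (hbd i).2 hnd p U V hp hU hV hU1 hV1 hUV hPc (hη i) (hdη i) (hderiv i)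

/-! ### The direction hypothesis is automatic for nonempty compact polytopes -/

omit [LinearOrder ι] in
/-- A nonempty compact H-polytope has, in every coordinate direction, a constraint with positive
and a constraint with negative `i`-th normal component (otherwise it would contain a half-line).
So the hypothesis `hbd` of `setIntegral_divergence_hPolytope_eq_facetSum` holds for every nonempty
compact `P`. [cite: EvansGariepy2015, Thm 5.16 (Gauss–Green), polyhedral case — plumbing] -/
theorem filter_sign_nonempty_of_isCompact {J : Finset ι} (a : ι → Fin 3 → ℝ) (b : ι → ℝ)
    (hPc : IsCompact {x : Fin 3 → ℝ | ∀ j ∈ J, ∑ l, a j l * x l ≤ b j})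
    (hPne : {x : Fin 3 → ℝ | ∀ j ∈ J, ∑ l, a j l * x l ≤ b j}.Nonempty) (i : Fin 3) :
    (J.filter fun j => 0 < a j i).Nonempty ∧ (J.filter fun j => a j i < 0).Nonempty := by
  classical
  obtain ⟨x₀, hx₀⟩ := hPne
  obtain ⟨R, hR⟩ := hPc.isBounded.subset_closedBall 0
  have hR' : ∀ x ∈ {x : Fin 3 → ℝ | ∀ j ∈ J, ∑ l, a j l * x l ≤ b j}, ‖x‖ ≤ R :=
    fun x hx => by simpa using hR hx
  have hR0 : 0 ≤ R := (norm_nonneg _).trans (hR' x₀ hx₀)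
  -- moving along `± e_i` by `t` changes the `j`-th constraint by `± t · a j i`
  have hline : ∀ (t : ℝ) (j : ι), ∑ l, a j l * (x₀ + t • (Pi.single i (1 : ℝ) : Fin 3 → ℝ)) l =
      ∑ l, a j l * x₀ l + t * a j i := by
    intro t j
    simp only [Pi.add_apply, Pi.smul_apply, smul_eq_mul, mul_add, Finset.sum_add_distrib]
    congr 1
    rw [Finset.sum_eq_single i]
    · simp [mul_comm]
    · intro l _ hl; simp [hl]
    · intro h; exact absurd (Finset.mem_univ i) h
  have hnorm : ∀ t : ℝ, |x₀ i + t| ≤ ‖x₀ + t • (Pi.single i (1 : ℝ) : Fin 3 → ℝ)‖ := by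
    intro t
    have := norm_le_pi_norm (x₀ + t • (Pi.single i (1 : ℝ) : Fin 3 → ℝ)) i
    simpa [Real.norm_eq_abs] using this
  constructor
  · by_contra hcon
    rw [Finset.not_nonempty_iff_eq_empty, Finset.filter_eq_empty_iff] at hcon
    -- all `a j i ≤ 0`: the half-line `x₀ + t e_i`, `t ≥ 0`, stays in `P`
    set t : ℝ := R + |x₀ i| + 1 with ht
    have hmem : (x₀ + t • (Pi.single i (1 : ℝ) : Fin 3 → ℝ)) ∈
        {x : Fin 3 → ℝ | ∀ j ∈ J, ∑ l, a j l * x l ≤ b j} := by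
      intro j hj
      rw [hline]
      have h3 : 0 ≤ t := by rw [ht]; positivity
      nlinarith [hx₀ j hj, not_lt.1 (hcon hj)]
    have : x₀ i + t ≤ R := (le_abs_self _).trans ((hnorm t).trans (hR' _ hmem))
    rw [ht] at this; linarith [neg_abs_le (x₀ i)]
  · by_contra hcon
    rw [Finset.not_nonempty_iff_eq_empty, Finset.filter_eq_empty_iff] at hcon
    set t : ℝ := R + |x₀ i| + 1 with ht
    have hmem : (x₀ + (-t) • (Pi.single i (1 : ℝ) : Fin 3 → ℝ)) ∈
        {x : Fin 3 → ℝ | ∀ j ∈ J, ∑ l, a j l * x l ≤ b j} := by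
      intro j hj
      rw [hline]
      have h3 : 0 ≤ t := by rw [ht]; positivity
      nlinarith [hx₀ j hj, not_lt.1 (hcon hj)]
    have : -(x₀ i + -t) ≤ R := (neg_le_abs _).trans ((hnorm (-t)).trans (hR' _ hmem))
    rw [ht] at this; linarith [le_abs_self (x₀ i)]

end Literature.MeasureTheory.Integral

end
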